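import Summits.Schanuel.Schanuel.Theorems.RootDecomp1KHyper47

/-!
# RootDecomp1KHyper — lens 6, generation 16/17 «ALGEBRAIC-LATTICE-ANCHORED CELL» (AlgLatAnchor.lean edition 2 42f80a0c…, 1588 l) — continuation (RootDecomp1KHyper48): §E0 the named engine pieces: the specialisation `engQ ∈ ℤ[x⃗][T]`, `engCC`, the evaluation `qev`, the norm `Res_T(f, Q)` and their bounds

(lens-6 g16/g17 `AlgLatAnchor.lean` edition 2, sha256 42f80a0c…8416, own farm rc 0 · 0 sorry · axioms std; critic VERDICT STATUS L1677 / L1713 PORT GO LOW;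
port by census-1 gen 15 in six parts `RootDecomp1KHyper47`–`52` — see the PORT NOTE of part 47; `--supports stmt-Schanuel-33363`; rung 0.)
-/

open Complex IntermediateField Polynomial

namespace Summit.Schanuel.Schanuel.Theorems.RootDecomp1KHyper

namespace HyperCell

namespace LatCell

variable {n : ℕ}
open Summit.Schanuel.Schanuel.Theorems.RootDecomp1KGeneric (HasHLPairInSpan Rank3SpanResidual
  mem_adjoin_of_mem_span cexp_mem_adjoin_of_mem_span)

/-- The binomial sum over `Fin (K+1)` with the vanishing binomial coefficients beyond `k`. -/
private theorem sum_fin_choose_eq_add_pow₄ {R : Type*} [CommRing R] {K : ℕ} (k : Fin (K + 1)) (u v : R) :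
    ∑ i : Fin (K + 1), ((Nat.choose k i : ℕ) : R) * u ^ (i : ℕ) * v ^ ((k : ℕ) - i) =
      (u + v) ^ (k : ℕ) := by
  have hk : (k : ℕ) + 1 ≤ K + 1 := Nat.succ_le_succ (Nat.lt_succ_iff.mp k.2)
  rw [Fin.sum_univ_eq_sum_range (fun i => ((Nat.choose k i : ℕ) : R) * u ^ i * v ^ ((k : ℕ) - i))
    (K + 1), add_pow]
  symm
  rw [← Finset.sum_subset (Finset.range_subset_range.mpr hk)]
  · exact Finset.sum_congr rfl fun i _ => by ring
  · intro i _ hi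
    have hlt : (k : ℕ) < i := by
      rw [Finset.mem_range] at hi; omega
    rw [Nat.choose_eq_zero_of_lt hlt]; simp

/-! ## §E  The RESULTANT ENGINE: extraction from an ALGEBRAIC lattice `ℤ + ℤω` against an arbitrary
weakly measured tuple `θ` -/

/-! ### §E0  The specialisation `Q ∈ ℤ[x⃗][T]`, its evaluation `qev`, and the norm `Res_T(f, Q)` — named pieces of
the engine (edition 2: cap reshaping; these were the local steps (2)–(6) of the gen-16 proof) -/

/-- `qev G A B E θ' r = Σ_k G_k(θ') (A + B r)^k E^{K−k}` — the value of the specialisation `Q` at `(θ', r)`. -/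
noncomputable def qev {K : ℕ} (G : Fin (K + 1) → MvPolynomial (Fin n) ℤ) (A B : ℤ) (E : ℕ)
    (θ' : Fin n → ℂ) (r : ℂ) : ℂ :=
  ∑ k : Fin (K + 1), MvPolynomial.aeval θ' (G k) *
    (((A : ℂ) + (B : ℂ) * r) ^ (k : ℕ) * (E : ℂ) ^ (K - k))

/-- The coefficient table `cc (k, j) = C(k, j) A^{k−j} B^j E^{K−k}`. -/
def engCC (K : ℕ) (A B : ℤ) (E : ℕ) (kj : Fin (K + 1) × Fin (K + 1)) : ℤ :=
  (Nat.choose kj.1 kj.2 : ℤ) * A ^ ((kj.1 : ℕ) - kj.2) * B ^ (kj.2 : ℕ) * (E : ℤ) ^ (K - kj.1)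

/-- `Q = Σ_j (Σ_k cc(k, j) G_k) T^j ∈ ℤ[x⃗][T]`, i.e. `Σ_k G_k (A + BT)^k E^{K−k}` expanded in `T`. -/
noncomputable def engQ {K : ℕ} (G : Fin (K + 1) → MvPolynomial (Fin n) ℤ) (A B : ℤ) (E : ℕ) :
    Polynomial (MvPolynomial (Fin n) ℤ) :=
  ∑ j : Fin (K + 1), Polynomial.monomial (j : ℕ) (mvcombo (fun k => engCC K A B E (k, j)) G)

/-- Coefficients of the specialisation `engQ`. -/
theorem engQ_coeff {K : ℕ} (G : Fin (K + 1) → MvPolynomial (Fin n) ℤ) (A B : ℤ) (E : ℕ) (t : ℕ) :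
    (engQ G A B E).coeff t =
      ∑ j : Fin (K + 1), if (j : ℕ) = t then mvcombo (fun k => engCC K A B E (k, j)) G else 0 := by
  rw [engQ, Polynomial.finsetSum_coeff]; simp only [Polynomial.coeff_monomial]

/-- Degree bound for the specialisation `engQ`. -/
theorem engQ_natDegree_le {K : ℕ} (G : Fin (K + 1) → MvPolynomial (Fin n) ℤ) (A B : ℤ) (E : ℕ) :
    (engQ G A B E).natDegree ≤ K := by
  rw [Polynomial.natDegree_le_iff_coeff_eq_zero]
  intro t ht
  rw [engQ_coeff]
  refine Finset.sum_eq_zero fun j _ => if_neg fun h => ?_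
  have := j.2; omega

/-- Size bound for the integer coefficients `engCC` of the specialisation. -/
theorem engCC_abs_le {K : ℕ} {A B : ℤ} {E : ℕ} {XZ : ℤ} (hXZ2 : 2 ≤ XZ) (hAXZ : |A| ≤ XZ)
    (hBXZ : |B| ≤ XZ) (hEXZ : (E : ℤ) ≤ XZ) (kj : Fin (K + 1) × Fin (K + 1)) :
    |engCC K A B E kj| ≤ XZ ^ (4 * K) := by
  have hXZ1 : 1 ≤ XZ := by linarith only [hXZ2]
  have hpowKZ : ∀ (t : ℤ), 0 ≤ t → t ≤ XZ → ∀ e : ℕ, e ≤ K → t ^ e ≤ XZ ^ K := by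
    intro t ht htX e he
    calc t ^ e ≤ XZ ^ e := pow_le_pow_left₀ ht htX e
      _ ≤ XZ ^ K := pow_le_pow_right₀ hXZ1 he
  have hk : (kj.1 : ℕ) ≤ K := Nat.lt_succ_iff.mp kj.1.2
  have hj : (kj.2 : ℕ) ≤ K := Nat.lt_succ_iff.mp kj.2.2
  have hchoose : ((Nat.choose kj.1 kj.2 : ℕ) : ℤ) ≤ XZ ^ K := by
    have h1 : ((Nat.choose kj.1 kj.2 : ℕ) : ℤ) ≤ ((2 ^ (kj.1 : ℕ) : ℕ) : ℤ) :=
      Nat.cast_le.mpr (Nat.choose_le_two_pow _ _)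
    have h2 : ((2 ^ (kj.1 : ℕ) : ℕ) : ℤ) = (2 : ℤ) ^ (kj.1 : ℕ) := by push_cast; ring
    rw [h2] at h1
    exact h1.trans (hpowKZ 2 (by norm_num) hXZ2 _ hk)
  simp only [engCC, abs_mul, abs_pow, Nat.abs_cast]
  calc ((Nat.choose kj.1 kj.2 : ℕ) : ℤ) * |A| ^ ((kj.1 : ℕ) - kj.2) * |B| ^ (kj.2 : ℕ) *
        (E : ℤ) ^ (K - kj.1)
      ≤ XZ ^ K * XZ ^ K * XZ ^ K * XZ ^ K := by
        refine mul_le_mul (mul_le_mul (mul_le_mul hchoose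
          (hpowKZ _ (abs_nonneg _) hAXZ _ ((Nat.sub_le _ _).trans hk)) (by positivity)
          (by positivity))
          (hpowKZ _ (abs_nonneg _) hBXZ _ hj) (by positivity)
          (by positivity)) (hpowKZ _ (by positivity) hEXZ _ (Nat.sub_le _ _)) (by positivity)
          (by positivity)
    _ = XZ ^ (4 * K) := by ring

/-- Length and degree of the coefficients of `Q`. -/
theorem engQ_coeff_bound {K : ℕ} (G : Fin (K + 1) → MvPolynomial (Fin n) ℤ) (A B : ℤ) (E : ℕ)
    {XZ : ℤ} (hXZ2 : 2 ≤ XZ) (hAXZ : |A| ≤ XZ) (hBXZ : |B| ≤ XZ) (hEXZ : (E : ℤ) ≤ XZ)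
    {Dg : ℕ} (hDg : ∀ k, (G k).totalDegree ≤ Dg) {B₀ : ℤ}
    (hB₀ : ((K + 1 : ℕ) : ℤ) * (∑ k, mvlen (G k)) ≤ B₀) (t : ℕ) :
    mvlen ((engQ G A B E).coeff t) ≤ B₀ * XZ ^ (4 * K) ∧
      ((engQ G A B E).coeff t).totalDegree ≤ Dg := by
  have hXZ0 : 0 ≤ XZ := by linarith only [hXZ2]
  have hX4 : 0 ≤ XZ ^ (4 * K) := pow_nonneg hXZ0 _
  have hΛ : 0 ≤ ∑ k, mvlen (G k) := Finset.sum_nonneg fun _ _ => mvlen_nonneg _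
  have hqqlen : ∀ j, mvlen (mvcombo (fun k => engCC K A B E (k, j)) G) ≤
      XZ ^ (4 * K) * ∑ k, mvlen (G k) := by
    intro j
    refine (mvlen_mvcombo_le _ _).trans ?_
    rw [Finset.mul_sum]
    exact Finset.sum_le_sum fun k _ =>
      mul_le_mul_of_nonneg_right (engCC_abs_le hXZ2 hAXZ hBXZ hEXZ (k, j)) (mvlen_nonneg _)
  have hqqdeg : ∀ j, (mvcombo (fun k => engCC K A B E (k, j)) G).totalDegree ≤ Dg := fun j =>
    totalDegree_mvcombo_le _ _ hDg
  rw [engQ_coeff]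
  refine ⟨(mvlen_sum_le _ _).trans ?_, MvPolynomial.totalDegree_finsetSum_le fun j _ => ?_⟩
  · have h1 : ∀ j : Fin (K + 1),
        mvlen (if (j : ℕ) = t then mvcombo (fun k => engCC K A B E (k, j)) G else 0) ≤
          XZ ^ (4 * K) * ∑ k, mvlen (G k) := by
      intro j
      split_ifs
      · exact hqqlen j
      · rw [mvlen_zero]; exact mul_nonneg hX4 hΛ
    calc ∑ j : Fin (K + 1), mvlen (if (j : ℕ) = t then mvcombo (fun k => engCC K A B E (k, j)) G else 0)
        ≤ ∑ _j : Fin (K + 1), XZ ^ (4 * K) * ∑ k, mvlen (G k) := Finset.sum_le_sum fun j _ => h1 j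
      _ = ((K + 1 : ℕ) : ℤ) * (∑ k, mvlen (G k)) * XZ ^ (4 * K) := by
          rw [Finset.sum_const, Finset.card_univ, Fintype.card_fin, nsmul_eq_mul]; push_cast; ring
      _ ≤ B₀ * XZ ^ (4 * K) := mul_le_mul_of_nonneg_right hB₀ hX4
  · split_ifs
    · exact hqqdeg j
    · rw [MvPolynomial.totalDegree_zero]; exact Nat.zero_le _

/-- The specialisation evaluates to `qev`: `Q(θ', r) = Σ_k G_k(θ') (A + B r)^k E^{K−k}` (binomial theorem). -/
theorem engQ_eval {K : ℕ} (G : Fin (K + 1) → MvPolynomial (Fin n) ℤ) (A B : ℤ) (E : ℕ)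
    (θ' : Fin n → ℂ) (r : ℂ) :
    ((engQ G A B E).map (MvPolynomial.aeval θ').toRingHom).eval r = qev G A B E θ' r := by
  rw [Polynomial.eval_map, engQ, Polynomial.eval₂_finsetSum]
  simp only [Polynomial.eval₂_monomial]
  have hφ : ∀ j, (MvPolynomial.aeval θ').toRingHom (mvcombo (fun k => engCC K A B E (k, j)) G) =
      ∑ k : Fin (K + 1), ((engCC K A B E (k, j) : ℤ) : ℂ) * MvPolynomial.aeval θ' (G k) := by
    intro j
    show MvPolynomial.aeval θ' _ = _
    exact aeval_mvcombo _ _ _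
  simp_rw [hφ]
  simp only [qev]
  calc ∑ j : Fin (K + 1), (∑ k : Fin (K + 1), ((engCC K A B E (k, j) : ℤ) : ℂ) *
          MvPolynomial.aeval θ' (G k)) * r ^ (j : ℕ)
      = ∑ k : Fin (K + 1), ∑ j : Fin (K + 1), ((engCC K A B E (k, j) : ℤ) : ℂ) *
          MvPolynomial.aeval θ' (G k) * r ^ (j : ℕ) := by
        rw [Finset.sum_comm]; exact Finset.sum_congr rfl fun j _ => Finset.sum_mul _ _ _
    _ = ∑ k : Fin (K + 1), MvPolynomial.aeval θ' (G k) *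
          (((A : ℂ) + (B : ℂ) * r) ^ (k : ℕ) * (E : ℂ) ^ (K - k)) := by
        refine Finset.sum_congr rfl fun k _ => ?_
        have hbin := sum_fin_choose_eq_add_pow₄ (R := ℂ) k ((B : ℂ) * r) (A : ℂ)
        have h1 : ∑ j : Fin (K + 1), ((engCC K A B E (k, j) : ℤ) : ℂ) * MvPolynomial.aeval θ' (G k) *
              r ^ (j : ℕ) =
            MvPolynomial.aeval θ' (G k) * (E : ℂ) ^ (K - k) *
              ∑ j : Fin (K + 1), ((Nat.choose k j : ℕ) : ℂ) * ((B : ℂ) * r) ^ (j : ℕ) *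
                (A : ℂ) ^ ((k : ℕ) - j) := by
          rw [Finset.mul_sum]
          refine Finset.sum_congr rfl fun j _ => ?_
          simp only [engCC]
          push_cast
          ring
        rw [h1, hbin]
        ring

/-- **Product formula** for the norm: `Res_T(f, Q)(θ') = ∏_{f(r)=0} Q(θ', r)` for monic `f ∈ ℤ[T]`. -/
theorem aeval_resultant_engQ {K : ℕ} (G : Fin (K + 1) → MvPolynomial (Fin n) ℤ) (A B : ℤ) (E : ℕ)
    {f : ℤ[X]} (hfm : f.Monic) {fC : ℂ[X]} (hfC : fC = f.map (algebraMap ℤ ℂ)) {d : ℕ}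
    (hd : d = fC.natDegree) (θ' : Fin n → ℂ) :
    MvPolynomial.aeval θ'
        (Polynomial.resultant (f.map (algebraMap ℤ (MvPolynomial (Fin n) ℤ))) (engQ G A B E) d K) =
      (fC.roots.map (qev G A B E θ')).prod := by
  have hfCm : fC.Monic := by rw [hfC]; exact hfm.map _
  have h1 : (MvPolynomial.aeval θ').toRingHom
      (Polynomial.resultant (f.map (algebraMap ℤ (MvPolynomial (Fin n) ℤ))) (engQ G A B E) d K) =
      Polynomial.resultant ((f.map (algebraMap ℤ (MvPolynomial (Fin n) ℤ))).map
        (MvPolynomial.aeval θ').toRingHom) ((engQ G A B E).map (MvPolynomial.aeval θ').toRingHom) d K := by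
    rw [Polynomial.resultant_map_map]
  have h2 : (f.map (algebraMap ℤ (MvPolynomial (Fin n) ℤ))).map (MvPolynomial.aeval θ').toRingHom = fC := by
    rw [Polynomial.map_map, hfC]
    congr 1
    exact RingHom.ext_int _ _
  have h3 : ((engQ G A B E).map (MvPolynomial.aeval θ').toRingHom).natDegree ≤ K :=
    (Polynomial.natDegree_map_le).trans (engQ_natDegree_le G A B E)
  have h4 := Polynomial.resultant_eq_prod_eval fC ((engQ G A B E).map (MvPolynomial.aeval θ').toRingHom) K
    h3 (IsAlgClosed.splits fC)
  rw [hfCm.leadingCoeff, one_pow, one_mul, ← hd] at h4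
  have h5 : fC.roots.map (fun r => ((engQ G A B E).map (MvPolynomial.aeval θ').toRingHom).eval r) =
      fC.roots.map (qev G A B E θ') := Multiset.map_congr rfl fun r _ => engQ_eval G A B E θ' r
  change (MvPolynomial.aeval θ').toRingHom _ = _
  rw [h1, h2, h4]
  exact congrArg _ h5

/-- **Conjugate transfer**: if the norm `Res_T(f, Q)` vanishes then some factor `Q(·, r)` vanishes identically,
hence (the coefficients of `Q(·, T)` being INTEGER polynomials in `T` and `f` irreducible) so does `Q(·, ω)`. -/
theorem qev_eq_zero_of_resultant_eq_zero {K : ℕ} (G : Fin (K + 1) → MvPolynomial (Fin n) ℤ)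
    (A B : ℤ) (E : ℕ) {f : ℤ[X]} (hfm : f.Monic) (hfi : Irreducible f) {ω : ℂ}
    (hω : Polynomial.aeval ω f = 0) {fC : ℂ[X]} (hfC : fC = f.map (algebraMap ℤ ℂ)) {d : ℕ}
    (hd : d = fC.natDegree) (θ : Fin n → ℂ)
    (hN : Polynomial.resultant (f.map (algebraMap ℤ (MvPolynomial (Fin n) ℤ))) (engQ G A B E) d K = 0) :
    qev G A B E θ ω = 0 := by
  classical
  have hfC0 : fC ≠ 0 := by rw [hfC]; exact (hfm.map _).ne_zero
  have hmem_roots : ∀ r : ℂ, r ∈ fC.roots ↔ Polynomial.aeval r f = 0 := by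
    intro r
    rw [Polynomial.mem_roots hfC0, Polynomial.IsRoot.def, hfC, Polynomial.eval_map,
      ← Polynomial.aeval_def]
  have hres := aeval_resultant_engQ G A B E hfm hfC hd
  set Φ : ℂ → MvPolynomial (Fin n) ℂ := fun r => ∑ k : Fin (K + 1),
    MvPolynomial.C (((A : ℂ) + (B : ℂ) * r) ^ (k : ℕ) * (E : ℂ) ^ (K - k)) *
      MvPolynomial.map (Int.castRingHom ℂ) (G k) with hΦdef
  have hΦeval : ∀ (r : ℂ) (θ' : Fin n → ℂ), MvPolynomial.eval θ' (Φ r) = qev G A B E θ' r := by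
    intro r θ'
    simp only [hΦdef, qev, map_sum, map_mul, MvPolynomial.eval_C]
    refine Finset.sum_congr rfl fun k _ => ?_
    rw [MvPolynomial.eval_map, ← algebraMap_int_eq, ← MvPolynomial.aeval_def]
    ring
  have hprod0 : (fC.roots.map Φ).prod = 0 := by
    apply MvPolynomial.funext
    intro θ'
    rw [map_zero, map_multiset_prod, Multiset.map_map]
    have h1 : fC.roots.map ((MvPolynomial.eval θ') ∘ Φ) = fC.roots.map (qev G A B E θ') :=
      Multiset.map_congr rfl fun r _ => hΦeval r θ'
    rw [h1, ← hres θ', hN, map_zero]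
  obtain ⟨r, hr, hΦr⟩ : ∃ r ∈ fC.roots, Φ r = 0 := by
    have h0 : (0 : MvPolynomial (Fin n) ℂ) ∈ fC.roots.map Φ := Multiset.prod_eq_zero_iff.mp hprod0
    obtain ⟨r, hr, h⟩ := Multiset.mem_map.mp h0
    exact ⟨r, hr, h⟩
  have hrf : Polynomial.aeval r f = 0 := (hmem_roots r).mp hr
  -- the integer coefficient polynomials g_e(T) = Σ_k E^{K-k} (G_k)_e (B T + A)^k
  set ge : (Fin n →₀ ℕ) → ℤ[X] := fun e => ∑ k : Fin (K + 1),
    Polynomial.C ((E : ℤ) ^ (K - k) * (G k).coeff e) *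
      (Polynomial.C B * Polynomial.X + Polynomial.C A) ^ (k : ℕ) with hgedef
  have hge : ∀ (e : Fin n →₀ ℕ) (s : ℂ),
      Polynomial.aeval s (ge e) = MvPolynomial.coeff e (Φ s) := by
    intro e s
    have hLs : Polynomial.aeval s (ge e) = ∑ k : Fin (K + 1),
        ((E : ℂ) ^ (K - k) * ((MvPolynomial.coeff e (G k) : ℤ) : ℂ)) *
          ((B : ℂ) * s + (A : ℂ)) ^ (k : ℕ) := by
      simp only [hgedef, Polynomial.aeval_def, Polynomial.eval₂_finsetSum, Polynomial.eval₂_mul,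
        Polynomial.eval₂_C, Polynomial.eval₂_pow, Polynomial.eval₂_add, Polynomial.eval₂_X]
      simp only [eq_intCast, Int.cast_mul, Int.cast_pow, Int.cast_natCast]
    have hRs : MvPolynomial.coeff e (Φ s) = ∑ k : Fin (K + 1),
        (((A : ℂ) + (B : ℂ) * s) ^ (k : ℕ) * (E : ℂ) ^ (K - k)) *
          ((MvPolynomial.coeff e (G k) : ℤ) : ℂ) := by
      simp only [hΦdef, MvPolynomial.coeff_sum, MvPolynomial.coeff_C_mul, MvPolynomial.coeff_map,
        eq_intCast]
    rw [hLs, hRs]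
    exact Finset.sum_congr rfl fun k _ => by ring
  have hΦω : Φ ω = 0 := by
    refine MvPolynomial.ext _ _ fun e => ?_
    rw [MvPolynomial.coeff_zero, ← hge e ω]
    refine aeval_eq_zero_of_conj hfm hfi hrf hω ?_
    rw [hge e r, hΦr, MvPolynomial.coeff_zero]
  rw [← hΦeval ω θ, hΦω, map_zero]

end LatCell

end HyperCell

end Summit.Schanuel.Schanuel.Theorems.RootDecomp1KHyper
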